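import Summits.CriticalPhenomena.PercolationContinuityZ3.Theorems.PercNearOneGluingNoHeavyLowerTailSunflowerTwoPointCompletingKernelB
import HarnessLib

/-!
# `NoHeavyLowerTail` (crux stmt-CriticalPhenomena-4575), abstract sunflower cubic: ★ (`0 ≤ ZH`) behind a TWO-POINT COMPLETING PAIR

Support file (seat `prim-ineq-gen-2` gen 25; `--supports stmt-CriticalPhenomena-4575`).  No `sorry`, no named facts; nothing is asserted about
the crux.  Assembly of the kernel checks `…TwoPointCompletingKernelA/B`.  Memo: run/shared/lean/prim/prim-ineq-gen-2/TWO-POINT-GEN25.md.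

THEOREM `Sunflower.ZH_nonneg_of_twoPointCompleting` (this work; a new unconditional class of the typed conjecture `PartitionLemmaH` = ★):
let `p ≠ q` be two points such that
* every PETAL set `X` avoiding `p` and `q` is completed by `p` (`lab (X + p) = ⊤`), and
* whenever `X` avoids `p, q` and `X + p`, `X + q` carry the same petal label, `lab (X + p + q) = ⊤` (no flat twin entry);
then `0 ≤ ZH`.  Petal sets containing `q` are unconstrained, so the class strictly contains the petal-completing class
(`Sunflower.ZH_nonneg_of_petalCompleting`, …OnePointCertificates): corollary `ZH_nonneg_of_petalCompleting_off`.  It was FOUND as the dominant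
class of an LP scan of the two-point code sets realised by the 504 six-point sunflowers without a good coordinate (gen 24, kit j168163: it
certifies 415 of them; no one-point class certifies any).

PROOF (architecture of `…SunflowerPiercedPair`).  Split the ordered 3-partitions of `α` by the blocks receiving `p` and `q` (`nested_insert_split`
twice): `ZH` becomes a nested sum over the 3-partitions `(X,S,T)` of `E' = univ ∖ {p,q}` of the nine-placement kernel `nineH` of the block data
`(lab X, lab (X+p), lab (X+q), lab (X+p+q))`, which under the hypotheses takes 42 values (`tcCode`, `exists_tcCode`).  Subtract four weighted
antipodal-Gladkov rows on the window `E' ∖ X` — plain (`nested_weight_mul_kk_nonneg`), polarised with offsets `{q} ⊇ ∅`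
(`nested_weight_mul_kk_insert_left_nonneg`), `q`-contraction (`nested_weight_mul_kk_insert_nonneg`) and `pq`-contraction
(`nested_weight_mul_kk_insert_insert_nonneg`), weights `tcW00, tcW20, tcW22, tcW33 ≥ 0` of the first block — and symmetrise
(`six_mul_nested_eq_symm6Of`): the symmetrised kernel is nonnegative on every code triple (`tcKer_symm_nonneg`, from the sorted check).
-/

namespace Summit.CriticalPhenomena.PercolationContinuityZ3.Theorems.SunflowerPartition

open Finset

/-- **Finite kernel check**: the symmetrised kernel is nonnegative on all `42³` code triples. [this work] -/
theorem tcKer_symm_nonneg (a b c : Fin 42) : 0 ≤ symm6Of tcKer (tcCode a) (tcCode b) (tcCode c) := by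
  have S := tcKer_symm_nonneg_sorted
  have P12 := fun x y z : Fin 42 => symm6Of_swap12 tcKer (tcCode x) (tcCode y) (tcCode z)
  have P23 := fun x y z : Fin 42 => symm6Of_swap23 tcKer (tcCode x) (tcCode y) (tcCode z)
  rcases le_total a b with hab | hba <;> rcases le_total b c with hbc | hcb <;> rcases le_total a c with hac | hca
  · exact S a b c hab hbc
  · exact S a b c hab hbc
  · rw [P23]; exact S a c b hac hcb
  · rw [P23, P12]; exact S c a b hca hab
  · rw [P12]; exact S b a c hba hac
  · rw [P12, P23]; exact S b c a hbc hca
  · rw [P12, P23, P12]; exact S c b a hcb hba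
  · rw [P12, P23, P12]; exact S c b a hcb hba

/-- Every admissible block-data quadruple — diamond monotonicity along the four inclusions, a petal `x` forces `xp = ⊤`, equal petal lifts
`xp = xq` force `xpq = ⊤` (a Boolean test, decided by enumeration) — is one of the 42 codes. [this work] -/
theorem exists_tcCode_of : ∀ x xp xq xpq : Fin 5,
    ((x = xp || x = 0 || xp = 4) && (x = xq || x = 0 || xq = 4) && (xp = xpq || xp = 0 || xpq = 4) && (xq = xpq || xq = 0 || xpq = 4) &&
      (x = 0 || x = 4 || xp = 4) && (xp ≠ xq || xp = 0 || xp = 4 || xpq = 4)) = true → ∃ c : Fin 42, tcCode c = (x, xp, xq, xpq) := by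
  decide

/-- Completion by `p` as a disjunction on the labels. [this work] -/
theorem or_of_completes : ∀ x xp : Fin 5, (x ≠ 0 → x ≠ 4 → xp = 4) → x = 0 ∨ x = 4 ∨ xp = 4 := by
  decide

/-- No flat twin entry as a disjunction on the labels. [this work] -/
theorem or_of_noFlatTwin : ∀ xp xq xpq : Fin 5, (xp = xq → xp ≠ 0 → xp ≠ 4 → xpq = 4) → xp ≠ xq ∨ xp = 0 ∨ xp = 4 ∨ xpq = 4 := by
  decide

variable {α : Type*} [DecidableEq α]

namespace Sunflower

variable (F : Sunflower α)

/-- Polarised rows `kk (lab (S+e)) (lab T)` with a nonnegative weight of the first block are nonnegative (polarised antipodal Gladkov with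
offsets `{e} ⊇ ∅` on every complement cube). [this work] -/
theorem nested_weight_mul_kk_insert_left_nonneg (W : Finset α) (e : α) (w : Finset α → ℤ) (hw : ∀ X, 0 ≤ w X) :
    0 ≤ nested W (fun X S T => w X * kk (F.lab (insert e S)) (F.lab T)) := by
  unfold nested
  refine sum_nonneg fun X _ => ?_
  rw [← mul_sum]
  refine mul_nonneg (hw X) ?_
  have h := F.antipodal_gladkov_polarized (W \ X) {e} ∅ (empty_subset _)
  refine le_of_le_of_eq h (sum_congr rfl fun S _ => ?_)
  rw [← insert_eq, empty_union]

/-- Pair-contraction rows `kk (lab (S+p+q)) (lab (T+p+q))` with a nonnegative weight of the first block are nonnegative (polarised antipodal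
Gladkov with equal offsets `{p,q}`). [this work] -/
theorem nested_weight_mul_kk_insert_insert_nonneg (W : Finset α) (p q : α) (w : Finset α → ℤ) (hw : ∀ X, 0 ≤ w X) :
    0 ≤ nested W (fun X S T => w X * kk (F.lab (insert p (insert q S))) (F.lab (insert p (insert q T)))) := by
  unfold nested
  refine sum_nonneg fun X _ => ?_
  rw [← mul_sum]
  refine mul_nonneg (hw X) ?_
  have h := F.antipodal_gladkov_polarized (W \ X) {p, q} {p, q} subset_rfl
  refine le_of_le_of_eq h (sum_congr rfl fun S _ => ?_)
  rw [insert_union, insert_union, ← insert_eq, ← insert_eq]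

/-- Behind a two-point completing pair, the block data of a set avoiding `p, q` is one of the 42 codes. [this work] -/
theorem exists_tcCode {p q : α}
    (h1 : ∀ X : Finset α, p ∉ X → q ∉ X → F.lab X ≠ 0 → F.lab X ≠ 4 → F.lab (insert p X) = 4)
    (h2 : ∀ X : Finset α, p ∉ X → q ∉ X → F.lab (insert p X) = F.lab (insert q X) → F.lab (insert p X) ≠ 0 →
      F.lab (insert p X) ≠ 4 → F.lab (insert p (insert q X)) = 4)
    {X : Finset α} (hp : p ∉ X) (hq : q ∉ X) : ∃ c : Fin 42, tcCode c = F.blockData p q X := by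
  unfold blockData
  have m1 := F.lab_mono (subset_insert p X)
  have m2 := F.lab_mono (subset_insert q X)
  have m3 := F.lab_mono (insert_subset_insert p (subset_insert q X))
  have m4 := F.lab_mono (subset_insert p (insert q X))
  have c1 := or_of_completes _ _ (h1 X hp hq)
  have c2 := or_of_noFlatTwin _ _ _ (h2 X hp hq)
  refine exists_tcCode_of _ _ _ _ ?_
  simp only [Bool.and_eq_true, Bool.or_eq_true, decide_eq_true_eq, or_assoc]
  exact ⟨⟨⟨⟨⟨m1, m2⟩, m3⟩, m4⟩, c1⟩, c2⟩

/-- **★ BEHIND A TWO-POINT COMPLETING PAIR**: if `p ≠ q`, every petal set `X` avoiding `p, q` has `lab (X+p) = ⊤`, and equal petal labels of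
`X+p`, `X+q` (for `X` avoiding `p, q`) force `lab (X+p+q) = ⊤`, then `0 ≤ ZH`. [this work] -/
theorem ZH_nonneg_of_twoPointCompleting [Fintype α] {p q : α} (hpq : p ≠ q)
    (h1 : ∀ X : Finset α, p ∉ X → q ∉ X → F.lab X ≠ 0 → F.lab X ≠ 4 → F.lab (insert p X) = 4)
    (h2 : ∀ X : Finset α, p ∉ X → q ∉ X → F.lab (insert p X) = F.lab (insert q X) → F.lab (insert p X) ≠ 0 →
      F.lab (insert p X) ≠ 4 → F.lab (insert p (insert q X)) = 4) : 0 ≤ F.ZH := by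
  set E' : Finset α := univ \ {p, q} with hE'
  have hpE : p ∉ E' := fun hh => (mem_sdiff.1 hh).2 (mem_insert_self _ _)
  have hqE : q ∉ E' := fun hh => (mem_sdiff.1 hh).2 (mem_insert_of_mem (mem_singleton_self _))
  have hpW : p ∉ insert q E' := fun hh => by
    rcases mem_insert.1 hh with hh | hh
    · exact hpq hh
    · exact hpE hh
  have huniv : (univ : Finset α) = insert p (insert q E') := by
    ext x
    simp only [mem_univ, mem_insert, hE', mem_sdiff, mem_singleton, true_and, true_iff]
    tauto
  set G : Finset α → Finset α → Finset α → ℤ := fun X S T => s6H (F.lab X) (F.lab S) (F.lab T) with hG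
  set L : Finset α → BlockData := F.blockData p q with hL
  -- ZH as a nested sum on `insert p (insert q E')`, split along `p` and `q`: nine placements minus the rows, plus the rows
  have hsplit : nested (insert p (insert q E')) G
      = nested E' (fun X S T => tcKer (L X) (L S) (L T))
        + (nested E' (fun X S T => tcW00 (L X) * kk (F.lab S) (F.lab T))
          + nested E' (fun X S T => tcW20 (L X) * kk (F.lab (insert q S)) (F.lab T))
          + nested E' (fun X S T => tcW22 (L X) * kk (F.lab (insert q S)) (F.lab (insert q T)))
          + nested E' (fun X S T => tcW33 (L X) * kk (F.lab (insert p (insert q S))) (F.lab (insert p (insert q T))))) := by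
    rw [nested_insert_split _ p hpW, nested_insert_split _ q hqE, nested_insert_split _ q hqE, nested_insert_split _ q hqE]
    unfold nested
    simp only [hG, hL, blockData, tcKer, nineH, sum_add_distrib, sum_sub_distrib]
    ring
  have hker : 0 ≤ nested E' (fun X S T => tcKer (L X) (L S) (L T)) := by
    have h6 := six_mul_nested_eq_symm6Of E' L tcKer
    have hpos : 0 ≤ nested E' (fun X S T => symm6Of tcKer (L X) (L S) (L T)) := by
      refine nested_nonneg_of_forall E' _ fun X hX S hS => ?_
      have hT : (E' \ X) \ S ⊆ E' := sdiff_subset.trans sdiff_subset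
      have hS' : S ⊆ E' := hS.trans sdiff_subset
      obtain ⟨a, ha⟩ := F.exists_tcCode h1 h2 (fun hh => hpE (hX hh)) (fun hh => hqE (hX hh))
      obtain ⟨b, hb⟩ := F.exists_tcCode h1 h2 (fun hh => hpE (hS' hh)) (fun hh => hqE (hS' hh))
      obtain ⟨c, hc⟩ := F.exists_tcCode h1 h2 (fun hh => hpE (hT hh)) (fun hh => hqE (hT hh))
      rw [hL, ← ha, ← hb, ← hc]
      exact tcKer_symm_nonneg a b c
    linarith
  have hrow0 : 0 ≤ nested E' (fun X S T => tcW00 (L X) * kk (F.lab S) (F.lab T)) :=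
    F.nested_weight_mul_kk_nonneg E' (fun X => tcW00 (L X)) fun X => tcW00_nonneg _
  have hrow1 : 0 ≤ nested E' (fun X S T => tcW20 (L X) * kk (F.lab (insert q S)) (F.lab T)) :=
    F.nested_weight_mul_kk_insert_left_nonneg E' q (fun X => tcW20 (L X)) fun X => tcW20_nonneg _
  have hrow2 : 0 ≤ nested E' (fun X S T => tcW22 (L X) * kk (F.lab (insert q S)) (F.lab (insert q T))) :=
    F.nested_weight_mul_kk_insert_nonneg E' q (fun X => tcW22 (L X)) fun X => tcW22_nonneg _
  have hrow3 : 0 ≤ nested E' (fun X S T => tcW33 (L X) * kk (F.lab (insert p (insert q S))) (F.lab (insert p (insert q T)))) :=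
    F.nested_weight_mul_kk_insert_insert_nonneg E' p q (fun X => tcW33 (L X)) fun X => tcW33_nonneg _
  have hZ : F.ZH = nested (insert p (insert q E')) G := by
    unfold ZH
    rw [sum_parts_eq_nested_univ (fun X S T => s6H (F.lab X) (F.lab S) (F.lab T)), huniv]
  rw [hZ, hsplit]
  linarith

/-- Corollary (the one-point class as a special case): if `p` completes every petal set avoiding `p` and `q`, and ALSO every petal set
`X + q` with `X` avoiding `p, q`, then `0 ≤ ZH` — in particular a petal-completing coordinate `p` (…OnePointCertificates) with any second
point `q`. [this work] -/
theorem ZH_nonneg_of_petalCompleting_off [Fintype α] {p q : α} (hpq : p ≠ q)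
    (h1 : ∀ X : Finset α, p ∉ X → q ∉ X → F.lab X ≠ 0 → F.lab X ≠ 4 → F.lab (insert p X) = 4)
    (h1q : ∀ X : Finset α, p ∉ X → q ∉ X → F.lab (insert q X) ≠ 0 → F.lab (insert q X) ≠ 4 → F.lab (insert p (insert q X)) = 4) :
    0 ≤ F.ZH :=
  F.ZH_nonneg_of_twoPointCompleting hpq h1 fun X hp hq he h0 h4 => h1q X hp hq (he ▸ h0) (he ▸ h4)

end Sunflower

end Summit.CriticalPhenomena.PercolationContinuityZ3.Theorems.SunflowerPartition
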